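import Literature.NumberTheory.DiophantineGeometry.AbcDarmonGranvilleCoeffProofs
import Literature.NumberTheory.DiophantineGeometry.FunctionFieldConstantExtensionRationalPlaces
import Literature.NumberTheory.NumberFields.HermiteFiniteness
import Mathlib.FieldTheory.IsAlgClosed.AlgebraicClosure
import Mathlib.FieldTheory.PrimitiveElement
import Mathlib.RingTheory.Unramified.LocalRing
import Mathlib.RingTheory.DedekindDomain.AdicValuation
import HarnessLib

/-!
# Darmon–Granville's Theorem 2 from the Riemann existence theorem, Beckmann's theorem and Faltings' theorem

Topic `NumberTheory/DiophantineGeometry`; **proof file: theorems only, no definitions, no named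
facts.** Target: the named fact
`Literature.NumberTheory.DiophantineGeometry.darmonGranville1995_thm_2` (`AbcWave0`; H. Darmon,
A. Granville, *On the equations `z^m = F(x, y)` and `A x^p + B y^q = C z^r`*, Bull. London Math.
Soc. **27** (1995) 513–543, Theorem 2, p. 515): for non-zero `A, B, C` and a hyperbolic signature
`(p, q, r)` the equation `A x^p + B y^q = C z^r` has finitely many proper solutions.

This file ASSEMBLES the printed proof (§3, pp. 524–527; detailed version: E. Bombieri, W. Gubler,
*Heights in Diophantine Geometry*, Thm. 12.6.15) and proves, sorry-free,

* `darmonGranville1995_thm_2_of_riemannExistence_of_beckmann_of_faltings (hRiemann) (hBeckmann)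
  (hFaltings) : darmonGranville1995_thm_2`

— Theorem 2 follows from THREE single published theorems, each taken as a hypothesis in its
printed shape and in the tree's function-field language (a covering `π : X → ℙ¹` over `K` is an
algebraic function field `F/K` with full constant field `K` together with `f ∈ F ∖ K`; the points of
the fibre `π⁻¹(t)`, `t ∈ K`, are the places `P` of `F/K` with `v_P(f - t) > 0`, and `K(P)` is the
residue field `F_P`):

* `hRiemann` — **DG Prop. 3.1 with the paragraph following it** (= B–G Cor. 12.6.7 (Riemann
  existence theorem / Fox), §12.6.8 (descent to a number field `K`, enlarged so that the fibres over
  `0, 1, ∞` are `K`-rational) and Prop. 12.6.9 (Hurwitz: `g ≥ 2`)): for every hyperbolic `(p, q, r)`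
  there are a number field `K` and a Galois covering `F ∋ f` of `ℙ¹_K` of signature `(p, q, r)` —
  `F/K(f)` Galois, every zero of `f` of order `p`, every zero of `f - 1` of order `q`, every pole of
  order `r`, unramified over every other closed point of `ℙ¹_K`, places over `0, 1, ∞` rational — of
  genus `≥ 2`;
* `hBeckmann` — **DG Prop. 3.2 = Beckmann's theorem** (S. Beckmann, J. reine angew. Math. **419**
  (1991); B–G Lemma 12.6.14): for such a covering there is a finite set `V` of finite places of `K`
  such that for `t ∈ K ∖ {0, 1}` and `v ∉ V` with `(t·0)_v ≡ 0 (p)`, `(t·1)_v ≡ 0 (q)`,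
  `(t·∞)_v ≡ 0 (r)` — `(t·0)_v = max(ord_v t, 0)` etc., display (3.1) — the field `K(P)` is
  unramified over `v` for every `P ∈ π⁻¹(t)`;
* `hFaltings` — **Faltings' theorem** in the shape of the tree's named fact
  `Literature.NumberTheory.DiophantineGeometry.finite_ratPlaces_of_two_le_genus` (for all number
  fields and function fields).

None of the three has a proof in the tree (the first two are not even stated; a proving seat may
not introduce named facts, D-0026), so `darmonGranville1995_thm_2_holds` is exactly this theorem once
they are available. EVERYTHING ELSE of the printed proof is proved, here or in the sibling files it
imports:

1. (p. 526, last paragraph) **the congruences (3.1) at every finite place `v ∤ A B C` of an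
   arbitrary number field `K`** for `t = A x^p / C z^r` coming from a proper solution with
   `x y z ≠ 0` (`dvd_interZero_coeffParam_place`, `dvd_interOne_coeffParam_place`,
   `dvd_interInfty_coeffParam_place`; `ord_v = -log ∘ v.valuation K`, Mathlib's normalised
   `v`-adic valuation) — the sibling `AbcDarmonGranvilleCoeffProofs` has them at rational primes;
2. (B–G Example 1.4.12, "`[K(P) : K] ≤ deg π`") `AlgFunctionField.degree_le_finrank_of_ord_sub_algebraMap_pos`;
3. (p. 527, "Minkowski's Theorem … the compositum `L` of all such fields `L_t` is a finite extension")
   Hermite's theorem `Literature.NumberTheory.NumberFields.finite_of_finrank_le_of_isUnramifiedAt`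
   (sibling `HermiteFiniteness`, from Mathlib's Hermite–Minkowski) applied inside `K̄`, transport of
   "unramified at `v`" along `K`-isomorphisms (`isUnramifiedAt_comap_iff`), the compositum `E`
   (finite-dimensional), a primitive element `θ` and `K' = K[X]/(minpoly θ) ≅ E`;
4. (p. 527, "Faltings' Theorem implies that `X(L)` is finite … only finitely many such `t`") the
   count `AlgFunctionField.finite_of_two_le_genus_of_finite_ratPlaces` of the sibling
   `FunctionFieldConstantExtensionRationalPlaces` (constant field extension `F K'/K'`, rational places
   above `K'`-embeddable residue fields, `g(F K'/K') ≥ g(F/K)`), packaged with 2–3 as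
   `AlgFunctionField.finite_of_fibres_isUnramifiedAt_of_finite_ratPlaces`: **granted Faltings, a set
   of parameters `t ∈ K` each of which has a fibre point `P ∈ π⁻¹(t)` with `K(P)/K` unramified outside
   a fixed finite set of places is finite**;
5. (p. 527, last sentence, and the solutions with `x y z = 0`) the reduction
   `darmonGranville1995_thm_2_iff_finite_coeffParam_image` of the sibling
   `AbcDarmonGranvilleCoeffProofs` (finite fibres of the parameter map).

## References

* [DarmonGranville1995] H. Darmon, A. Granville, Bull. London Math. Soc. 27 (1995), Theorem 2
  (p. 515), §3: Prop. 3.1 (p. 525), Prop. 3.2 and (3.1) (p. 526), proof of Theorem 2 (pp. 526–527).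
* [BombieriGubler2006] E. Bombieri, W. Gubler, *Heights in Diophantine Geometry*, CUP 2006:
  Cor. 12.6.7, §12.6.8, Prop. 12.6.9, §12.6.10, Lemma 12.6.14, Thm. 12.6.15, Example 1.4.12,
  Cor. B.2.15.
* S. Beckmann, *On extensions of number fields obtained by specializing branched coverings*,
  J. reine angew. Math. 419 (1991), 27–53.
* [Faltings1983Endlichkeit] G. Faltings, Invent. Math. 73 (1983), §6 Satz 7.
* [Stichtenoth2009] H. Stichtenoth, *Algebraic Function Fields and Codes*, GTM 254, Prop. 1.3.3.
-/

noncomputable section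

open scoped Classical Polynomial IntermediateField
open Polynomial IsDedekindDomain NumberField WithZero

namespace Literature.NumberTheory.DiophantineGeometry

/-! ### 1. The congruences (3.1) at the finite places `v ∤ A B C` of a number field -/

section Places

variable {K : Type*} [Field K] [NumberField K]

/-- An integer outside the finite place `v` is a `v`-adic unit. [folklore] -/
theorem valuation_intCast_eq_one_of_not_mem (v : HeightOneSpectrum (𝓞 K)) {n : ℤ}
    (hn : (n : 𝓞 K) ∉ v.asIdeal) : v.valuation K (n : K) = 1 := by
  have e : (n : K) = algebraMap (𝓞 K) K (n : 𝓞 K) := by simp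
  rw [e, HeightOneSpectrum.valuation_eq_one_iff_notMem]
  exact hn

/-- Integers are `v`-adic integers (private copy of the tree's
`Literature.NumberTheory.EllipticCurves.heightOneSpectrum_valuation_intCast_le_one`, whose module is
outside this import cone). [folklore] -/
private theorem valuation_intCast_le_one (v : HeightOneSpectrum (𝓞 K)) (n : ℤ) :
    v.valuation K (n : K) ≤ 1 := by
  have e : (n : K) = algebraMap (𝓞 K) K (n : 𝓞 K) := by simp
  rw [e]
  exact HeightOneSpectrum.valuation_le_one v _

/-- `ord_v n ≥ 0` for a non-zero integer `n`, i.e. `log |n|_v ≤ 0`. [folklore] -/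
theorem log_valuation_intCast_nonpos (v : HeightOneSpectrum (𝓞 K)) {n : ℤ} (hn : n ≠ 0) :
    log (v.valuation K (n : K)) ≤ 0 := by
  have h0 : v.valuation K (n : K) ≠ 0 :=
    (Valuation.ne_zero_iff _).mpr (Int.cast_ne_zero.mpr hn)
  rw [← log_one, log_le_log h0 one_ne_zero]
  exact valuation_intCast_le_one v n

/-- **The local computation behind (3.1)** at a finite place `v` of a number field `K`. Let
`a, b` be integers outside `v` and `u, w` non-zero integers not both in `v`. Then the arithmetic
intersection number `max(ord_v (a u^m / b w^n), 0)` is divisible by `m`: it equals `m · ord_v u` if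
`w ∉ v` and `0` if `w ∈ v` (then `u ∉ v` and `ord_v (a u^m / b w^n) = -n · ord_v w ≤ 0`). Here
`ord_v = -log ∘ v.valuation K` is the normalised valuation (`t = π_v^{ord_v t} · unit`, p. 526).
[folklore] -/
theorem dvd_max_neg_log_valuation_coeff_mul_pow_div (v : HeightOneSpectrum (𝓞 K)) {a b u w : ℤ}
    (ha : (a : 𝓞 K) ∉ v.asIdeal) (hb : (b : 𝓞 K) ∉ v.asIdeal) (hu : u ≠ 0) (hw : w ≠ 0)
    (huw : ¬ ((u : 𝓞 K) ∈ v.asIdeal ∧ (w : 𝓞 K) ∈ v.asIdeal)) (m n : ℕ) :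
    (m : ℤ) ∣ max (-log (v.valuation K ((a : K) * (u : K) ^ m / ((b : K) * (w : K) ^ n)))) 0 := by
  have hva := valuation_intCast_eq_one_of_not_mem v ha
  have hvb := valuation_intCast_eq_one_of_not_mem v hb
  have hU0 : v.valuation K (u : K) ≠ 0 := (Valuation.ne_zero_iff _).mpr (Int.cast_ne_zero.mpr hu)
  have hW0 : v.valuation K (w : K) ≠ 0 := (Valuation.ne_zero_iff _).mpr (Int.cast_ne_zero.mpr hw)
  have hlog : log (v.valuation K ((a : K) * (u : K) ^ m / ((b : K) * (w : K) ^ n))) =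
      (m : ℤ) * log (v.valuation K (u : K)) - (n : ℤ) * log (v.valuation K (w : K)) := by
    rw [map_div₀, map_mul, map_mul, map_pow, map_pow, hva, hvb, one_mul, one_mul,
      log_div (pow_ne_zero _ hU0) (pow_ne_zero _ hW0), log_pow, log_pow]
    simp
  rw [hlog]
  by_cases hwv : (w : 𝓞 K) ∈ v.asIdeal
  · have huv : (u : 𝓞 K) ∉ v.asIdeal := fun h => huw ⟨h, hwv⟩
    have hlu : log (v.valuation K (u : K)) = 0 := by
      rw [valuation_intCast_eq_one_of_not_mem v huv, log_one]
    have hlw := log_valuation_intCast_nonpos v hw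
    rw [hlu, mul_zero, zero_sub, neg_neg, max_eq_right (by nlinarith)]
    exact dvd_zero _
  · have hlw : log (v.valuation K (w : K)) = 0 := by
      rw [valuation_intCast_eq_one_of_not_mem v hwv, log_one]
    have hlu := log_valuation_intCast_nonpos v hu
    rw [hlw, mul_zero, sub_zero, max_eq_left (by nlinarith)]
    exact ⟨-log (v.valuation K (u : K)), by ring⟩

omit [NumberField K] in
/-- Three integers with `gcd(x, y, z) = 1` do not all lie in a proper ideal: if `x, y ∈ v` then
`z ∉ v` (the contraction of `v` to `ℤ` is principal, and a generator dividing `x, y, z` is a unit).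
[folklore] -/
theorem not_mem_of_gcd_eq_one (v : HeightOneSpectrum (𝓞 K)) {x y z : ℤ}
    (hg : ({x, y, z} : Finset ℤ).gcd id = 1) (hx : (x : 𝓞 K) ∈ v.asIdeal)
    (hy : (y : 𝓞 K) ∈ v.asIdeal) : (z : 𝓞 K) ∉ v.asIdeal := by
  intro hz
  set I : Ideal ℤ := v.asIdeal.comap (Int.castRingHom (𝓞 K)) with hI
  have hgI : Ideal.span {Submodule.IsPrincipal.generator I} = I := Ideal.span_singleton_generator I
  have hmem : ∀ n : ℤ, (n : 𝓞 K) ∈ v.asIdeal → Submodule.IsPrincipal.generator I ∣ n := by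
    intro n hn
    rw [← Ideal.mem_span_singleton, hgI, hI, Ideal.mem_comap]
    simpa using hn
  have hunit : IsUnit (Submodule.IsPrincipal.generator I) :=
    isUnit_of_dvd_of_gcd_eq_one hg (hmem x hx) (hmem y hy) (hmem z hz)
  have htop : I = ⊤ := by
    rw [← hgI, Ideal.span_singleton_eq_top]
    exact hunit
  have h1 : (1 : 𝓞 K) ∈ v.asIdeal := by
    have h1I : (1 : ℤ) ∈ I := htop ▸ Submodule.mem_top
    rw [hI, Ideal.mem_comap] at h1I
    simpa using h1I
  exact v.isPrime.ne_top ((Ideal.eq_top_iff_one _).mpr h1)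

omit [NumberField K] in
/-- In a proper solution of `A x^p + B y^q = C z^r` (`p, r ≠ 0`), a finite place `v ∌ B` does not
contain both `x` and `z`: it would contain `B y^q`, hence `y`, contradicting `gcd(x, y, z) = 1`
(B–G, proof of Thm. 12.6.15: "our assumptions on `S` and `GCD(x, y, z) = 1` yield the congruences").
[folklore] -/
theorem not_mem_and_mem_of_proper (v : HeightOneSpectrum (𝓞 K)) {A B C x y z : ℤ} {p q r : ℕ}
    (hp : p ≠ 0) (hr : r ≠ 0) (hB : (B : 𝓞 K) ∉ v.asIdeal)
    (hg : ({x, y, z} : Finset ℤ).gcd id = 1) (he : A * x ^ p + B * y ^ q = C * z ^ r) :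
    ¬ ((x : 𝓞 K) ∈ v.asIdeal ∧ (z : 𝓞 K) ∈ v.asIdeal) := by
  rintro ⟨hx, hz⟩
  have he' : (B : 𝓞 K) * (y : 𝓞 K) ^ q =
      (C : 𝓞 K) * (z : 𝓞 K) ^ r - (A : 𝓞 K) * (x : 𝓞 K) ^ p := by
    have h' : ((A * x ^ p + B * y ^ q : ℤ) : 𝓞 K) = ((C * z ^ r : ℤ) : 𝓞 K) := by rw [he]
    push_cast at h'
    linear_combination h'
  have hByq : (B : 𝓞 K) * (y : 𝓞 K) ^ q ∈ v.asIdeal := by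
    rw [he']
    exact sub_mem (Ideal.mul_mem_left _ _ (v.asIdeal.pow_mem_of_mem hz r (Nat.pos_of_ne_zero hr)))
      (Ideal.mul_mem_left _ _ (v.asIdeal.pow_mem_of_mem hx p (Nat.pos_of_ne_zero hp)))
  have hy : (y : 𝓞 K) ∈ v.asIdeal :=
    v.isPrime.mem_of_pow_mem q ((v.isPrime.mem_or_mem hByq).resolve_left hB)
  exact not_mem_of_gcd_eq_one v hg hx hy hz

omit [NumberField K] in
/-- A place not containing `A B C` contains none of `A`, `B`, `C`. [folklore] -/
theorem not_mem_of_not_mem_mul_three (v : HeightOneSpectrum (𝓞 K)) {A B C : ℤ}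
    (h : ((A * B * C : ℤ) : 𝓞 K) ∉ v.asIdeal) :
    (A : 𝓞 K) ∉ v.asIdeal ∧ (B : 𝓞 K) ∉ v.asIdeal ∧ (C : 𝓞 K) ∉ v.asIdeal := by
  push_cast at h
  exact ⟨fun hA => h (Ideal.mul_mem_right _ _ (Ideal.mul_mem_right _ _ hA)),
    fun hB => h (Ideal.mul_mem_right _ _ (Ideal.mul_mem_left _ _ hB)),
    fun hC => h (Ideal.mul_mem_left _ _ hC)⟩

/-- **(3.1) at `0`, at a finite place `v ∤ A B C` of a number field `K`.** For a proper solution of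
`A x^p + B y^q = C z^r` with `x z ≠ 0` (`p, r ≠ 0`), the parameter `t = A x^p / C z^r ∈ K` has
`p ∣ (t·0)_v := max(ord_v t, 0)` — "The congruences in (3.1) are satisfied if `v` does not divide
`A`, `B` or `C`" (p. 526), here for the places of an arbitrary number field `K ⊇ ℚ` (the field of
definition of the covering). [cite: DarmonGranville1995, §3, (3.1) and proof of Theorem 2 (p. 526)] -/
theorem dvd_interZero_coeffParam_place (v : HeightOneSpectrum (𝓞 K)) {A B C x y z : ℤ}
    {p q r : ℕ} (hp : p ≠ 0) (hr : r ≠ 0) (hv : ((A * B * C : ℤ) : 𝓞 K) ∉ v.asIdeal)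
    (hg : ({x, y, z} : Finset ℤ).gcd id = 1) (he : A * x ^ p + B * y ^ q = C * z ^ r)
    (hx : x ≠ 0) (hz : z ≠ 0) :
    (p : ℤ) ∣ max (-log (v.valuation K ((A : K) * (x : K) ^ p / ((C : K) * (z : K) ^ r)))) 0 := by
  obtain ⟨hA, hB, hC⟩ := not_mem_of_not_mem_mul_three v hv
  exact dvd_max_neg_log_valuation_coeff_mul_pow_div v hA hC hx hz
    (not_mem_and_mem_of_proper v hp hr hB hg he) p r

/-- `t - 1 = (-B) y^q / C z^r` for the parameter `t = A x^p / C z^r` of a solution, in any field of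
characteristic `0` (p. 526). [cite: DarmonGranville1995, §3, proof of Theorem 2 (p. 526)] -/
theorem coeffParam_sub_one_field {L : Type*} [Field L] [CharZero L] {A B C x y z : ℤ}
    {p q r : ℕ} (hC : C ≠ 0) (hz : z ≠ 0) (he : A * x ^ p + B * y ^ q = C * z ^ r) :
    (A : L) * (x : L) ^ p / ((C : L) * (z : L) ^ r) - 1 =
      ((-B : ℤ) : L) * (y : L) ^ q / ((C : L) * (z : L) ^ r) := by
  have hQ : (C : L) * (z : L) ^ r ≠ 0 :=
    mul_ne_zero (Int.cast_ne_zero.mpr hC) (pow_ne_zero _ (Int.cast_ne_zero.mpr hz))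
  rw [div_sub_one hQ]
  congr 1
  have h' : ((A * x ^ p + B * y ^ q : ℤ) : L) = ((C * z ^ r : ℤ) : L) := by rw [he]
  push_cast at h' ⊢
  linear_combination h'

/-- **(3.1) at `1`, at a finite place `v ∤ A B C`.** For a proper solution with `y z ≠ 0`
(`q, r ≠ 0`), `q ∣ (t·1)_v := max(ord_v (t - 1), 0)` (as `t - 1 = (-B) y^q / C z^r`).
[cite: DarmonGranville1995, §3, (3.1) and proof of Theorem 2 (p. 526)] -/
theorem dvd_interOne_coeffParam_place (v : HeightOneSpectrum (𝓞 K)) {A B C x y z : ℤ}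
    {p q r : ℕ} (hq : q ≠ 0) (hr : r ≠ 0) (hv : ((A * B * C : ℤ) : 𝓞 K) ∉ v.asIdeal)
    (hg : ({x, y, z} : Finset ℤ).gcd id = 1) (he : A * x ^ p + B * y ^ q = C * z ^ r)
    (hy : y ≠ 0) (hz : z ≠ 0) :
    (q : ℤ) ∣ max (-log (v.valuation K
      ((A : K) * (x : K) ^ p / ((C : K) * (z : K) ^ r) - 1))) 0 := by
  obtain ⟨hA, hB, hC⟩ := not_mem_of_not_mem_mul_three v hv
  have hC0 : C ≠ 0 := fun h => hC (by rw [h, Int.cast_zero]; exact zero_mem _)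
  rw [coeffParam_sub_one_field hC0 hz he]
  have hg' : ({y, x, z} : Finset ℤ).gcd id = 1 := by rwa [Finset.insert_comm]
  have hB' : ((-B : ℤ) : 𝓞 K) ∉ v.asIdeal := by
    rw [Int.cast_neg]
    exact fun h => hB (by simpa using v.asIdeal.neg_mem h)
  exact dvd_max_neg_log_valuation_coeff_mul_pow_div v hB' hC hy hz
    (not_mem_and_mem_of_proper v hq hr hA hg'
      (show B * y ^ q + A * x ^ p = C * z ^ r by rw [add_comm]; exact he)) q r

/-- **(3.1) at `∞`, at a finite place `v ∤ A B C`.** For a proper solution with `x z ≠ 0`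
(`p, r ≠ 0`), `r ∣ (t·∞)_v := max(ord_v (1/t), 0)` (`1/t = C z^r / A x^p`).
[cite: DarmonGranville1995, §3, (3.1) and proof of Theorem 2 (p. 526)] -/
theorem dvd_interInfty_coeffParam_place (v : HeightOneSpectrum (𝓞 K)) {A B C x y z : ℤ}
    {p q r : ℕ} (hp : p ≠ 0) (hr : r ≠ 0) (hv : ((A * B * C : ℤ) : 𝓞 K) ∉ v.asIdeal)
    (hg : ({x, y, z} : Finset ℤ).gcd id = 1) (he : A * x ^ p + B * y ^ q = C * z ^ r)
    (hx : x ≠ 0) (hz : z ≠ 0) :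
    (r : ℤ) ∣ max (-log (v.valuation K
      ((A : K) * (x : K) ^ p / ((C : K) * (z : K) ^ r))⁻¹)) 0 := by
  obtain ⟨hA, hB, hC⟩ := not_mem_of_not_mem_mul_three v hv
  rw [inv_div]
  exact dvd_max_neg_log_valuation_coeff_mul_pow_div v hC hA hz hx
    (fun h => not_mem_and_mem_of_proper v hp hr hB hg he ⟨h.2, h.1⟩) r p

/-- The finite places of `K` dividing a fixed non-zero integer are finitely many
("`V_{ABC}` (the union of `V` and the places dividing `A B C`)", p. 526; private copy of the tree's
`WeierstrassCurve.finite_setOf_intCast_mem_asIdeal` of `EllipticCurves/SelmerUnramified`, outside this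
import cone). [folklore] -/
private theorem finite_setOf_intCast_mem {N : ℤ} (hN : N ≠ 0) :
    {v : HeightOneSpectrum (𝓞 K) | (N : 𝓞 K) ∈ v.asIdeal}.Finite := by
  have hN' : Ideal.span {(N : 𝓞 K)} ≠ ⊥ := by
    rw [Ne, Ideal.span_singleton_eq_bot]
    exact Int.cast_ne_zero.mpr hN
  refine (Ideal.finite_factors hN').subset fun v hv => ?_
  simpa [Ideal.dvd_span_singleton] using hv

end Places

/-! ### 2. Transport of "unramified at `v`" along isomorphisms -/

section Transport

/-- "Unramified at a prime" is transported along an isomorphism of algebras (the localisations at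
corresponding primes are isomorphic). [folklore] -/
theorem isUnramifiedAt_comap_iff {R S S' : Type*} [CommRing R] [CommRing S] [CommRing S']
    [Algebra R S] [Algebra R S'] (e : S ≃ₐ[R] S') (Q : Ideal S') [Q.IsPrime] :
    Algebra.IsUnramifiedAt R (Q.comap e) ↔ Algebra.IsUnramifiedAt R Q := by
  have H : Submonoid.map e (Q.comap e).primeCompl = Q.primeCompl := by
    ext y
    simp only [Submonoid.mem_map, Ideal.mem_primeCompl_iff, Ideal.mem_comap]
    constructor
    · rintro ⟨x, hx, rfl⟩
      exact hx
    · intro hy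
      exact ⟨e.symm y, by simpa using hy, by simp⟩
  let f : Localization.AtPrime (Q.comap e) ≃ₐ[R] Localization.AtPrime Q :=
    IsLocalization.algEquivOfAlgEquiv (A := R) (M := (Q.comap e).primeCompl)
      (Localization.AtPrime (Q.comap e)) (T := Q.primeCompl) (Localization.AtPrime Q) e H
  unfold Algebra.IsUnramifiedAt
  exact Algebra.FormallyUnramified.iff_of_equiv f

/-- Restricting a `k`-isomorphism of fields to the rings of integers (Mathlib's
`RingOfIntegers.mapAlgEquiv`) does not change the contractions of primes to `𝓞 k`. [folklore] -/
theorem under_comap_mapAlgEquiv {k L L' : Type*} [Field k] [Field L] [Field L']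
    [Algebra k L] [Algebra k L'] (e : L ≃ₐ[k] L') (Q : Ideal (𝓞 L')) :
    (Q.comap (RingOfIntegers.mapAlgEquiv e)).under (𝓞 k) = Q.under (𝓞 k) := by
  ext x
  simp only [Ideal.under_def, Ideal.mem_comap, AlgEquiv.commutes]

end Transport

/-! ### 3. Degrees of fibre points, and the Hermite–Faltings count -/

namespace AlgFunctionField

universe u v

section DegreeBound

variable {K : Type u} {F : Type v} [Field K] [Field F] [Algebra K F]

/-- `K(f - t) = K(f)` for a constant `t` (a private copy of the tree's
`AlgFunctionField.adjoin_simple_sub_algebraMap` of `FunctionFieldRationalPlaceBoundsProofs`, not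
imported here to keep the import cone small). [folklore] -/
private theorem adjoin_simple_sub_algebraMap_aux (f : F) (t : K) : K⟮f - algebraMap K F t⟯ = K⟮f⟯ := by
  apply le_antisymm
  · rw [IntermediateField.adjoin_simple_le_iff]
    exact sub_mem (IntermediateField.mem_adjoin_simple_self K f) (algebraMap_mem _ t)
  · rw [IntermediateField.adjoin_simple_le_iff]
    have hmem : f - algebraMap K F t + algebraMap K F t ∈ K⟮f - algebraMap K F t⟯ :=
      add_mem (IntermediateField.mem_adjoin_simple_self K _) (algebraMap_mem _ t)
    rwa [sub_add_cancel] at hmem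

/-- A non-constant `f` stays non-constant after subtracting a constant. [folklore] -/
theorem sub_algebraMap_not_mem_range {f : F} (hf : f ∉ Set.range (algebraMap K F)) (t : K) :
    f - algebraMap K F t ∉ Set.range (algebraMap K F) := by
  rintro ⟨c, hc⟩
  exact hf ⟨c + t, by rw [map_add, hc, sub_add_cancel]⟩

/-- **`[F_P : K] ≤ [F : K(f)]` for a point `P` of the fibre `f = t`** (Bombieri–Gubler,
Example 1.4.12, as used in the proof of Thm. 12.6.15: "we have `[K(P) : K] ≤ deg(π)`"; Stichtenoth
Prop. 1.3.3: `deg P ≤ v_P(f - t) · deg P ≤ deg (f - t)_0 ≤ [F : K(f - t)] = [F : K(f)]`).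
[cite: BombieriGubler2006, Example 1.4.12 and proof of Thm. 12.6.15] -/
theorem degree_le_finrank_of_ord_sub_algebraMap_pos [IsAlgFunctionField K F]
    [IsIntegrallyClosedIn K F] {f : F} (hf : f ∉ Set.range (algebraMap K F)) (t : K)
    (P : PlaceOver K F) (hP : 0 < P.ord (f - algebraMap K F t)) :
    P.degree ≤ Module.finrank K⟮f⟯ F := by
  have hx : Transcendental K (f - algebraMap K F t) :=
    transcendental_of_not_mem_range (sub_algebraMap_not_mem_range hf t)
  have h := sum_ord_mul_degree_le_finrank_int hx {P} (by simpa using hP)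
  rw [Finset.sum_singleton, adjoin_simple_sub_algebraMap_aux] at h
  have h1 : (P.degree : ℤ) ≤ P.ord (f - algebraMap K F t) * (P.degree : ℤ) :=
    le_mul_of_one_le_left (by positivity) hP
  exact_mod_cast h1.trans h

end DegreeBound

section Count

variable {K : Type u} [Field K] [NumberField K] {F : Type v} [Field F] [Algebra K F]
  [IsAlgFunctionField K F] [IsIntegrallyClosedIn K F]

/-- **Hermite + Faltings: parameters whose fibres are unramified outside a fixed finite set of
places are finitely many** (Darmon–Granville, p. 527, from "Minkowski's Theorem asserts" to
"Therefore there are only finitely many such `t`"; Bombieri–Gubler, proof of Thm. 12.6.15). Let `K`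
be a number field, `F/K` a function field with full constant field `K` of genus `≥ 2`,
`f ∈ F ∖ K` (the covering `π : X → ℙ¹`, `d = [F : K(f)]`), `S` a finite set of finite places of `K`,
and grant Faltings' theorem for the constant field extensions `F[X]/(φ)` of `F` over the number
fields `K[X]/(φ)` (the named fact
`Literature.NumberTheory.DiophantineGeometry.finite_ratPlaces_of_two_le_genus`, as a hypothesis). If
every `t ∈ T ⊆ K` has a point `P ∈ π⁻¹(t)` (a place with `v_P(f - t) > 0`) whose residue field
`K(P) = F_P` is unramified over `𝓞 K` at every prime above a place outside `S`, then `T` is finite.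
Proof as printed: `[F_P : K] ≤ d` (`degree_le_finrank_of_ord_sub_algebraMap_pos`); by Hermite's
theorem (`Literature.NumberTheory.NumberFields.finite_of_finrank_le_of_isUnramifiedAt`, inside
`Ω = K̄`, after transporting unramifiedness along `F_P ≅ σ(F_P) ⊆ Ω`) the fields `σ(F_P)` range over a
finite set, so their compositum `E` is a finite extension of `K`; with a primitive element `θ` of
`E/K`, `K' = K[X]/(minpoly θ) ≅ E` receives every `F_P`, and
`finite_of_two_le_genus_of_finite_ratPlaces` (Faltings over `K'`, `g(F K'/K') ≥ g(F/K) ≥ 2`, one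
rational place of `F K'` above each `P`, distinct `t` having distinct `P`) bounds `T`.
[cite: DarmonGranville1995, §3, proof of Theorem 2 (p. 527)]
[cite: BombieriGubler2006, proof of Thm. 12.6.15] -/
theorem finite_of_fibres_isUnramifiedAt_of_finite_ratPlaces {f : F}
    (hf : f ∉ Set.range (algebraMap K F)) (hg : 2 ≤ genus K F)
    (hFaltings : ∀ (φ : K[X]) [Fact (Irreducible φ)],
      finite_ratPlaces_of_two_le_genus (AdjoinRoot φ) (AdjoinRoot (φ.map (algebraMap K F))))
    {S : Set (HeightOneSpectrum (𝓞 K))} (hS : S.Finite) {T : Set K}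
    (hT : ∀ t ∈ T, ∃ P : PlaceOver K F, 0 < P.ord (f - algebraMap K F t) ∧
      ∀ v : HeightOneSpectrum (𝓞 K), v ∉ S → ∀ (𝔓 : Ideal (𝓞 P.residueField)) [𝔓.IsMaximal],
        𝔓.under (𝓞 K) = v.asIdeal → Algebra.IsUnramifiedAt (𝓞 K) 𝔓) :
    T.Finite := by
  -- the ambient field `Ω = K̄`, the degree bound `d = [F : K(f)]`, the excluded primes `S'`
  let Ω := AlgebraicClosure K
  haveI : CharZero Ω := charZero_of_injective_algebraMap (algebraMap K Ω).injective
  let d : ℕ := Module.finrank K⟮f⟯ F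
  let S' : Set (Ideal (𝓞 K)) := (fun v : HeightOneSpectrum (𝓞 K) => v.asIdeal) '' S
  have hS' : S'.Finite := hS.image _
  -- Hermite: the admissible subfields of `Ω` (degree `≤ d`, unramified outside `S'`) are finitely many
  have hH := Literature.NumberTheory.NumberFields.finite_of_finrank_le_of_isUnramifiedAt K Ω hS' d
  set H := {L : { E : IntermediateField K Ω // FiniteDimensional K E } |
      Module.finrank K L ≤ d ∧ ∀ (𝔓 : Ideal (𝓞 L)) [𝔓.IsMaximal], 𝔓.under (𝓞 K) ∉ S' →
        Algebra.IsUnramifiedAt (𝓞 K) 𝔓 } with hHdef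
  haveI : Finite H := hH.to_subtype
  -- their compositum `E`, a finite extension of `K`, and `K' = K[X]/(φ) ≅ E`, `φ = minpoly θ`
  let E : IntermediateField K Ω :=
    ⨆ L : H, (L : { E : IntermediateField K Ω // FiniteDimensional K E }).1
  haveI : ∀ L : H, FiniteDimensional K
      ((fun L : H => (L : { E : IntermediateField K Ω // FiniteDimensional K E }).1) L) :=
    fun L => L.1.2
  haveI hEfd : FiniteDimensional K E := IntermediateField.finiteDimensional_iSup_of_finite
  obtain ⟨θ, hθ⟩ := Field.exists_primitive_element K E
  have hθint : IsIntegral K θ := IsIntegral.of_finite K θ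
  let φ : K[X] := minpoly K θ
  haveI hirr : Fact (Irreducible φ) := ⟨minpoly.irreducible hθint⟩
  let ψ : E →ₐ[K] AdjoinRoot φ :=
    (IntermediateField.adjoinRootEquivAdjoin K hθint).symm.toAlgHom.comp
      (((IntermediateField.equivOfEq hθ).symm.toAlgHom).comp
        (IntermediateField.topEquiv (F := K) (E := E)).symm.toAlgHom)
  -- the count over `K'`
  refine finite_of_two_le_genus_of_finite_ratPlaces (K := K) (F := F) φ (hFaltings φ) hg
    (f := f) (T := T) fun t ht => ?_
  obtain ⟨P, hPt, hP⟩ := hT t ht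
  refine ⟨P, hPt, ?_⟩
  -- the residue field `F_P`, embedded into `Ω` as `L = σ(F_P)`
  haveI : FiniteDimensional K P.residueField := PlaceOver.finiteDimensional_residueField_holds P
  let σ : P.residueField →ₐ[K] Ω := IsAlgClosed.lift
  let L : IntermediateField K Ω := σ.fieldRange
  let e : P.residueField ≃ₐ[K] L := AlgEquiv.ofInjectiveField σ
  haveI hLfd : FiniteDimensional K L := LinearEquiv.finiteDimensional e.toLinearEquiv
  -- `L` is admissible: `[L : K] = deg P ≤ d`, and `L/K` is unramified outside `S'`
  have hLH : (⟨L, hLfd⟩ : { E : IntermediateField K Ω // FiniteDimensional K E }) ∈ H := by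
    rw [hHdef]
    refine ⟨?_, ?_⟩
    · change Module.finrank K L ≤ d
      rw [← e.toLinearEquiv.finrank_eq]
      exact degree_le_finrank_of_ord_sub_algebraMap_pos hf t P hPt
    · intro 𝔓 h𝔓 hunder
      -- `w = 𝔓 ∩ 𝓞 K` is a finite place `v ∉ S` of `K`
      haveI : Algebra.IsIntegral (𝓞 K) (𝓞 L) := Algebra.IsIntegral.tower_top (R := ℤ)
      haveI hwmax : (𝔓.under (𝓞 K)).IsMaximal := Ideal.IsMaximal.under (𝓞 K) 𝔓
      have hw0 : 𝔓.under (𝓞 K) ≠ ⊥ :=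
        Ring.ne_bot_of_isMaximal_of_not_isField hwmax (RingOfIntegers.not_isField K)
      let v : HeightOneSpectrum (𝓞 K) := ⟨𝔓.under (𝓞 K), hwmax.isPrime, hw0⟩
      have hvS : v ∉ S := fun hvS => hunder ⟨v, hvS, rfl⟩
      -- transport from `F_P ≅ L`
      refine (isUnramifiedAt_comap_iff (RingOfIntegers.mapAlgEquiv e) 𝔓).mp ?_
      haveI := Ideal.comap_isMaximal_of_surjective (RingOfIntegers.mapAlgEquiv e)
        (RingOfIntegers.mapAlgEquiv e).surjective (K := 𝔓)
      exact hP v hvS _ (under_comap_mapAlgEquiv e 𝔓)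
  -- hence `F_P ≅ L ⊆ E ≅ K'`
  have hLE : L ≤ E :=
    le_iSup (fun L : H => (L : { E : IntermediateField K Ω // FiniteDimensional K E }).1) ⟨_, hLH⟩
  exact ⟨ψ.comp ((IntermediateField.inclusion hLE).comp e.toAlgHom)⟩

end Count

end AlgFunctionField

/-! ### 4. Theorem 2 from the three printed inputs -/

section Assembly

open AlgFunctionField

/-- **Darmon–Granville's Theorem 2 from the Riemann existence theorem, Beckmann's theorem and
Faltings' theorem** (the printed proof, §3, pp. 524–527; Bombieri–Gubler Thm. 12.6.15). The three
hypotheses are the three published theorems the printed proof quotes, in the tree's function-field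
language (`F/K` = the function field `K(X)` of the covering curve `X`, `f` = the covering map
`π : X → ℙ¹`, places `P` with `v_P(f - t) > 0` = the points of `π⁻¹(t)`, `F_P` = `K(P)`):

* `hRiemann` — **Prop. 3.1 and the paragraph after it** (Riemann existence theorem + "a standard
  specialization argument", with Riemann–Hurwitz; B–G Cor. 12.6.7, §12.6.8, Prop. 12.6.9): for all
  hyperbolic `(p, q, r)` there exist a number field `K`, an algebraic function field `F/K` with full
  constant field `K` and `f ∈ F ∖ K` with `F/K(f)` Galois ("the automorphisms of `Gal(X/ℙ¹)` are also
  defined over `K`"), of signature `(p, q, r)` — every zero of `f` has order `p`, every zero of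
  `f - 1` order `q`, every pole order `r`, and `π` is unramified over every other closed point of
  `ℙ¹_K` (monic irreducible `π₀ ≠ X, X - 1`: `v_P(π₀(f)) ∈ {0, 1}`) —, all places over `0, 1, ∞`
  rational (B–G §12.6.8: "we may assume that all fibre points over `0, 1, ∞` are `K`-rational"), and
  genus `g ≥ 2` ("If `χ(p, q, r) < 0`, then `g > 1`");
* `hBeckmann` — **Prop. 3.2 (Beckmann)** (B–G Lemma 12.6.14: "the extension `K(P)/K` is unramified
  over `v` for every `P ∈ π⁻¹(Q)`"): for such `(K, F, f)` there is a finite set `V` of finite places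
  of `K` such that for `t ∈ K ∖ {0, 1}` and `v ∉ V` with `(t·0)_v ≡ 0 (mod p)`,
  `(t·1)_v ≡ 0 (mod q)`, `(t·∞)_v ≡ 0 (mod r)` — display (3.1), `(t·0)_v = max(ord_v t, 0)`,
  `(t·1)_v = max(ord_v (t - 1), 0)`, `(t·∞)_v = max(ord_v (1/t), 0)`, `ord_v = -log ∘ v.valuation K`
  the normalised valuation — every `K(P)`, `P ∈ π⁻¹(t)`, is unramified over `𝓞 K` at the primes
  above `v`;
* `hFaltings` — **Faltings' theorem** ("Faltings' Theorem implies that `X(L)` is finite"), as the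
  tree's named fact `finite_ratPlaces_of_two_le_genus` for every function field over a number field.

Proof (pp. 526–527): reduce to the finiteness of the parameters `t = A x^p / C z^r` of the proper
solutions with `x y z ≠ 0` (`darmonGranville1995_thm_2_iff_finite_coeffParam_image`); take the
covering of `hRiemann` and the set `V` of `hBeckmann`; for `v ∉ V_{ABC} = V ∪ {v ∣ A B C}` the
congruences (3.1) hold (`dvd_interZero_coeffParam_place` & co.), so `K(P)/K` is unramified outside
`V_{ABC}` for `P ∈ π⁻¹(t)` (`exists_ord_pos_of_transcendental` provides `P`); conclude by
`AlgFunctionField.finite_of_fibres_isUnramifiedAt_of_finite_ratPlaces` (Minkowski–Hermite,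
compositum `L`, Faltings over `L`, finitely many `t`). Once the three inputs are theorems of the
tree, `darmonGranville1995_thm_2_holds` is this theorem applied to them.
[cite: DarmonGranville1995, Theorem 2 (p. 515); §3, Prop. 3.1 (p. 525), Prop. 3.2 (p. 526), proof of Theorem 2 (pp. 526–527)]
[cite: BombieriGubler2006, Thm. 12.6.15 (proof), Lemma 12.6.14, Cor. 12.6.7, Prop. 12.6.9] -/
theorem darmonGranville1995_thm_2_of_riemannExistence_of_beckmann_of_faltings
    (hRiemann : ∀ p q r : ℕ, q * r + r * p + p * q < p * q * r →
      ∃ (K : Type) (_ : Field K) (_ : NumberField K) (F : Type) (_ : Field F) (_ : Algebra K F)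
        (_ : IsAlgFunctionField K F) (_ : IsIntegrallyClosedIn K F) (f : F),
        f ∉ Set.range (algebraMap K F) ∧ IsGalois K⟮f⟯ F ∧
        (∀ P : PlaceOver K F, 0 < P.ord f → P.ord f = p) ∧
        (∀ P : PlaceOver K F, 0 < P.ord (f - 1) → P.ord (f - 1) = q) ∧
        (∀ P : PlaceOver K F, P.ord f < 0 → P.ord f = -r) ∧
        (∀ π₀ : K[X], Irreducible π₀ → π₀.Monic → π₀ ≠ X → π₀ ≠ X - 1 →
          ∀ P : PlaceOver K F, 0 < P.ord (aeval f π₀) → P.ord (aeval f π₀) = 1) ∧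
        (∀ P : PlaceOver K F, (0 < P.ord f ∨ 0 < P.ord (f - 1) ∨ P.ord f < 0) → P.IsRational) ∧
        2 ≤ genus K F)
    (hBeckmann : ∀ (K : Type) [Field K] [NumberField K] (F : Type) [Field F] [Algebra K F]
        [IsAlgFunctionField K F] [IsIntegrallyClosedIn K F] (f : F) (p q r : ℕ),
      f ∉ Set.range (algebraMap K F) → IsGalois K⟮f⟯ F →
      (∀ P : PlaceOver K F, 0 < P.ord f → P.ord f = p) →
      (∀ P : PlaceOver K F, 0 < P.ord (f - 1) → P.ord (f - 1) = q) →
      (∀ P : PlaceOver K F, P.ord f < 0 → P.ord f = -r) →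
      (∀ π₀ : K[X], Irreducible π₀ → π₀.Monic → π₀ ≠ X → π₀ ≠ X - 1 →
        ∀ P : PlaceOver K F, 0 < P.ord (aeval f π₀) → P.ord (aeval f π₀) = 1) →
      (∀ P : PlaceOver K F, (0 < P.ord f ∨ 0 < P.ord (f - 1) ∨ P.ord f < 0) → P.IsRational) →
      ∃ V : Set (HeightOneSpectrum (𝓞 K)), V.Finite ∧
        ∀ t : K, t ≠ 0 → t ≠ 1 → ∀ v : HeightOneSpectrum (𝓞 K), v ∉ V →
          (p : ℤ) ∣ max (-log (v.valuation K t)) 0 →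
          (q : ℤ) ∣ max (-log (v.valuation K (t - 1))) 0 →
          (r : ℤ) ∣ max (-log (v.valuation K t⁻¹)) 0 →
          ∀ P : PlaceOver K F, 0 < P.ord (f - algebraMap K F t) →
            ∀ (𝔓 : Ideal (𝓞 P.residueField)) [𝔓.IsMaximal], 𝔓.under (𝓞 K) = v.asIdeal →
              Algebra.IsUnramifiedAt (𝓞 K) 𝔓)
    (hFaltings : ∀ (K' : Type) [Field K'] (F' : Type) [Field F'] [Algebra K' F'],
      finite_ratPlaces_of_two_le_genus K' F') :
    darmonGranville1995_thm_2 := by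
  refine darmonGranville1995_thm_2_iff_finite_coeffParam_image.mpr
    fun A B C hA hB hC p q r hpqr => ?_
  obtain ⟨hp, hq, hr⟩ := hyperbolic_exponents_ne_zero hpqr
  -- Prop. 3.1: the covering; Prop. 3.2: its set of bad places `V`
  obtain ⟨K, _, _, F, _, _, _, _, f, hf, hGal, h₀, h₁, hi, hunr, hrat, hg⟩ := hRiemann p q r hpqr
  obtain ⟨V, hV, hBeck⟩ := hBeckmann K F f p q r hf hGal h₀ h₁ hi hunr hrat
  -- move the parameters into `K`
  have hinj : Function.Injective (algebraMap ℚ K) := (algebraMap ℚ K).injective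
  refine Set.Finite.of_finite_image (f := algebraMap ℚ K) ?_ hinj.injOn
  -- `V_{ABC}`: `V` and the places dividing `A B C`
  have hABC : A * B * C ≠ 0 := mul_ne_zero (mul_ne_zero hA hB) hC
  refine finite_of_fibres_isUnramifiedAt_of_finite_ratPlaces hf hg (fun φ _ => hFaltings _ _)
    (hV.union (finite_setOf_intCast_mem (K := K) hABC)) ?_
  rintro _ ⟨_, ⟨⟨x, y, z⟩, ⟨hgcd, he, h0⟩, rfl⟩, rfl⟩
  dsimp only at hgcd he h0 ⊢
  have hx : x ≠ 0 := fun h => h0 (by rw [h, zero_mul, zero_mul])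
  have hy : y ≠ 0 := fun h => h0 (by rw [h, mul_zero, zero_mul])
  have hz : z ≠ 0 := fun h => h0 (by rw [h, mul_zero])
  -- the parameter `t = A x^p / C z^r ∈ K ∖ {0, 1}`
  have ht : algebraMap ℚ K ((A : ℚ) * (x : ℚ) ^ p / ((C : ℚ) * (z : ℚ) ^ r)) =
      (A : K) * (x : K) ^ p / ((C : K) * (z : K) ^ r) := by
    rw [map_div₀, map_mul, map_mul, map_pow, map_pow]
    simp
  rw [ht]
  have ht0 : (A : K) * (x : K) ^ p / ((C : K) * (z : K) ^ r) ≠ 0 := by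
    rw [← ht, _root_.map_ne_zero]
    exact coeffParam_ne_zero hA hC hx hz p r
  have ht1 : (A : K) * (x : K) ^ p / ((C : K) * (z : K) ^ r) ≠ 1 := by
    rw [← ht, ← (algebraMap ℚ K).map_one, hinj.ne_iff]
    exact coeffParam_ne_one hB hC hy hz he
  -- a point `P ∈ π⁻¹(t)`; `K(P)/K` is unramified outside `V_{ABC}` by (3.1) and Prop. 3.2
  obtain ⟨P, hP⟩ := exists_ord_pos_of_transcendental
    (transcendental_of_not_mem_range (sub_algebraMap_not_mem_range hf _))
  refine ⟨P, hP, fun v hv 𝔓 _ h𝔓 => ?_⟩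
  simp only [Set.mem_union, Set.mem_setOf_eq, not_or] at hv
  exact hBeck _ ht0 ht1 v hv.1 (dvd_interZero_coeffParam_place v hp hr hv.2 hgcd he hx hz)
    (dvd_interOne_coeffParam_place v hq hr hv.2 hgcd he hy hz)
    (dvd_interInfty_coeffParam_place v hp hr hv.2 hgcd he hx hz) P hP 𝔓 h𝔓

/-- **The record `darmon_granville` (abc.S18, `A = B = C = 1`, positive pairwise coprime solutions)
from the same three printed inputs** — Riemann existence theorem with descent (DG Prop. 3.1),
Beckmann's theorem (DG Prop. 3.2) and Faltings' theorem — through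
`darmon_granville_of_darmonGranville1995_thm_2` (sibling `AbcDarmonGranvilleCoeffProofs`). The
hypotheses are those of `darmonGranville1995_thm_2_of_riemannExistence_of_beckmann_of_faltings`,
verbatim. [cite: DarmonGranville1995, Theorem 2 (p. 515) and §3, Props. 3.1, 3.2, proof of Theorem 2 (pp. 524–527)] -/
theorem darmon_granville_of_riemannExistence_of_beckmann_of_faltings
    (hRiemann : ∀ p q r : ℕ, q * r + r * p + p * q < p * q * r →
      ∃ (K : Type) (_ : Field K) (_ : NumberField K) (F : Type) (_ : Field F) (_ : Algebra K F)
        (_ : IsAlgFunctionField K F) (_ : IsIntegrallyClosedIn K F) (f : F),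
        f ∉ Set.range (algebraMap K F) ∧ IsGalois K⟮f⟯ F ∧
        (∀ P : PlaceOver K F, 0 < P.ord f → P.ord f = p) ∧
        (∀ P : PlaceOver K F, 0 < P.ord (f - 1) → P.ord (f - 1) = q) ∧
        (∀ P : PlaceOver K F, P.ord f < 0 → P.ord f = -r) ∧
        (∀ π₀ : K[X], Irreducible π₀ → π₀.Monic → π₀ ≠ X → π₀ ≠ X - 1 →
          ∀ P : PlaceOver K F, 0 < P.ord (aeval f π₀) → P.ord (aeval f π₀) = 1) ∧
        (∀ P : PlaceOver K F, (0 < P.ord f ∨ 0 < P.ord (f - 1) ∨ P.ord f < 0) → P.IsRational) ∧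
        2 ≤ genus K F)
    (hBeckmann : ∀ (K : Type) [Field K] [NumberField K] (F : Type) [Field F] [Algebra K F]
        [IsAlgFunctionField K F] [IsIntegrallyClosedIn K F] (f : F) (p q r : ℕ),
      f ∉ Set.range (algebraMap K F) → IsGalois K⟮f⟯ F →
      (∀ P : PlaceOver K F, 0 < P.ord f → P.ord f = p) →
      (∀ P : PlaceOver K F, 0 < P.ord (f - 1) → P.ord (f - 1) = q) →
      (∀ P : PlaceOver K F, P.ord f < 0 → P.ord f = -r) →
      (∀ π₀ : K[X], Irreducible π₀ → π₀.Monic → π₀ ≠ X → π₀ ≠ X - 1 →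
        ∀ P : PlaceOver K F, 0 < P.ord (aeval f π₀) → P.ord (aeval f π₀) = 1) →
      (∀ P : PlaceOver K F, (0 < P.ord f ∨ 0 < P.ord (f - 1) ∨ P.ord f < 0) → P.IsRational) →
      ∃ V : Set (HeightOneSpectrum (𝓞 K)), V.Finite ∧
        ∀ t : K, t ≠ 0 → t ≠ 1 → ∀ v : HeightOneSpectrum (𝓞 K), v ∉ V →
          (p : ℤ) ∣ max (-log (v.valuation K t)) 0 →
          (q : ℤ) ∣ max (-log (v.valuation K (t - 1))) 0 →
          (r : ℤ) ∣ max (-log (v.valuation K t⁻¹)) 0 →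
          ∀ P : PlaceOver K F, 0 < P.ord (f - algebraMap K F t) →
            ∀ (𝔓 : Ideal (𝓞 P.residueField)) [𝔓.IsMaximal], 𝔓.under (𝓞 K) = v.asIdeal →
              Algebra.IsUnramifiedAt (𝓞 K) 𝔓)
    (hFaltings : ∀ (K' : Type) [Field K'] (F' : Type) [Field F'] [Algebra K' F'],
      finite_ratPlaces_of_two_le_genus K' F') :
    darmon_granville :=
  darmon_granville_of_darmonGranville1995_thm_2
    (darmonGranville1995_thm_2_of_riemannExistence_of_beckmann_of_faltings hRiemann hBeckmann
      hFaltings)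

end Assembly

end Literature.NumberTheory.DiophantineGeometry
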